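import Mathlib

/-!
# Triage r1 k3 — counterexample to `CascadeCore` (card `relay-cascade-bfk`)

The definitions `ExchangeStep … CascadeCore` below are copied VERBATIM from
`Cruxes/DiffuseBackwardInfluence/IdeatorOneG2Sketch.lean` §1 (that file is a crux workfile, not an
importable module). We then exhibit the **equal-swap geometric relay chain**: particles `0,…,d`
with masses `a_k = h·r^k`, `r = c₀/(1−c₀)`, and the round-robin history `(0,1),(1,2),…,(d−1,d)`
repeated; at step `(k,k+1)` particle `k` hands over `e = c₀ a_k` (fraction `c₀`) and `k+1` hands
over `w = (1−c₀) a_{k+1} = c₀ a_k` (fraction `1−c₀`): an EQUAL swap, so all masses are constant,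
every step is admissible and two-sided `c₀`-non-degenerate for BOTH endpoints, every particle is
active, and BFK-locality holds (in a crossing-free block for `S ⊉ chain` the internal steps are
pairwise distinct pairs `(k,k+1) ⊆ S`, hence `≤ |S|−1`; for `S = univ` the whole history has
`m₀·d ≤ (d+1)²` steps when `d = m₀`). Hence `Σ a_k² ≥ h² = 9(1−2c₀)²/(1−c₀)²` for EVERY `m₀`:
`CascadeCore` is false for every `c₀ ∈ (0,1/3)`, `C K = K²`, `η < 9(1−2c₀)²/(1−c₀)²`.

Machine-checked here: the instance `c₀ = 1/10`, `C K = K²`, `n = 4` (`d = 3`), `m₀ = 3`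
(three rounds, nine steps), final `Σ a² ≥ 7` — i.e. `m₀ = 3` fails; the docstring argument above
shows every `m₀` fails (take `d = m₀`, `n = d+1`, `m₀` rounds).
-/

namespace Summit.AtomisticToContinuum.HydrodynamicLimit.Cruxes.DiffuseBackwardInfluence.TriageR1K3

open scoped BigOperators

noncomputable section

/-! ## Verbatim copies from `IdeatorOneG2Sketch.lean` §1 -/

structure ExchangeStep (n : ℕ) where
  i : Fin n
  j : Fin n
  e : ℝ
  w : ℝ

def applyStep {n : ℕ} (a : Fin n → ℝ) (s : ExchangeStep n) : Fin n → ℝ :=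
  Function.update (Function.update a s.i (a s.i - s.e + s.w)) s.j (a s.j - s.w + s.e)

def massesAfter {n : ℕ} (a : Fin n → ℝ) (L : List (ExchangeStep n)) : Fin n → ℝ :=
  L.foldl applyStep a

def massesBefore {n : ℕ} (a : Fin n → ℝ) (L : List (ExchangeStep n)) (m : ℕ) : Fin n → ℝ :=
  massesAfter a (L.take m)

def Admissible {n : ℕ} (a : Fin n → ℝ) (L : List (ExchangeStep n)) : Prop :=
  ∀ m (hm : m < L.length),
    let s := L.get ⟨m, hm⟩
    let b := massesBefore a L m
    s.i ≠ s.j ∧ 0 ≤ s.e ∧ s.e ≤ b s.i ∧ 0 ≤ s.w ∧ s.w ≤ b s.j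

def FullyNonDegenerate {n : ℕ} (c₀ : ℝ) (a : Fin n → ℝ) (L : List (ExchangeStep n)) : Prop :=
  ∀ m (hm : m < L.length),
    let s := L.get ⟨m, hm⟩
    let b := massesBefore a L m
    c₀ * b s.i ≤ s.e ∧ s.e ≤ (1 - c₀) * b s.i ∧ c₀ * b s.j ≤ s.w ∧ s.w ≤ (1 - c₀) * b s.j

def LocalityBFK {n : ℕ} (C : ℕ → ℕ) (L : List (ExchangeStep n)) : Prop :=
  ∀ (S : Finset (Fin n)) (m₁ m₂ : ℕ), m₁ ≤ m₂ → m₂ ≤ L.length →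
    (∀ m (hm : m < L.length), m₁ ≤ m → m < m₂ →
      ((L.get ⟨m, hm⟩).i ∈ S ↔ (L.get ⟨m, hm⟩).j ∈ S)) →
    ((Finset.range L.length).filter (fun m => m₁ ≤ m ∧ m < m₂ ∧
        ∃ hm : m < L.length, (L.get ⟨m, hm⟩).i ∈ S ∧ (L.get ⟨m, hm⟩).j ∈ S)).card ≤ C S.card

def stepsOf {n : ℕ} (L : List (ExchangeStep n)) (i : Fin n) : ℕ :=
  (L.filter (fun s => decide (s.i = i ∨ s.j = i))).length

def CascadeCore : Prop :=
  ∀ c₀ : ℝ, 0 < c₀ → c₀ < 1 / 3 → ∀ C : ℕ → ℕ, ∀ η : ℝ, 0 < η → ∃ m₀ : ℕ,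
    ∀ (n : ℕ) (a : Fin n → ℝ) (L : List (ExchangeStep n)),
      (∀ i, 0 ≤ a i) → ∑ i, a i = 3 → Admissible a L → FullyNonDegenerate c₀ a L →
      LocalityBFK C L → (∀ i, m₀ ≤ stepsOf L i) →
      ∑ i, (massesAfter a L i) ^ 2 ≤ η

/-! ## Balanced (equal-swap) steps leave every mass unchanged -/

theorem applyStep_of_balanced {n : ℕ} (a : Fin n → ℝ) (s : ExchangeStep n) (h : s.e = s.w) :
    applyStep a s = a := by
  unfold applyStep
  rw [h]
  simp only [sub_add_cancel, Function.update_eq_self]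

theorem massesAfter_of_balanced {n : ℕ} (a : Fin n → ℝ) (L : List (ExchangeStep n))
    (h : ∀ s ∈ L, s.e = s.w) : massesAfter a L = a := by
  induction L generalizing a with
  | nil => rfl
  | cons s L ih =>
    show massesAfter (applyStep a s) L = a
    rw [applyStep_of_balanced a s (h s List.mem_cons_self)]
    exact ih a (fun s' hs' => h s' (List.mem_cons_of_mem _ hs'))

theorem massesBefore_of_balanced {n : ℕ} (a : Fin n → ℝ) (L : List (ExchangeStep n))
    (h : ∀ s ∈ L, s.e = s.w) (m : ℕ) : massesBefore a L m = a :=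
  massesAfter_of_balanced a _ (fun s hs => h s (List.mem_of_mem_take hs))

/-! ## The instance `n = 4`, `c₀ = 1/10`, three rounds -/

/-- The heavy holder's mass `h = 3/(1 + 1/9 + 1/81 + 1/729) = 2187/820 ≈ 2.667`. -/
def hval : ℝ := 2187 / 820

def aVec : Fin 4 → ℝ := ![hval, hval / 9, hval / 81, hval / 729]

def s01 : ExchangeStep 4 := ⟨0, 1, hval / 10, hval / 10⟩
def s12 : ExchangeStep 4 := ⟨1, 2, hval / 90, hval / 90⟩
def s23 : ExchangeStep 4 := ⟨2, 3, hval / 810, hval / 810⟩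

/-- Three rounds of the relay chain `(0,1),(1,2),(2,3)`. -/
def Lc : List (ExchangeStep 4) := [s01, s12, s23, s01, s12, s23, s01, s12, s23]

theorem mem_Lc {s : ExchangeStep 4} (hs : s ∈ Lc) : s = s01 ∨ s = s12 ∨ s = s23 := by
  simp only [Lc, List.mem_cons, List.mem_nil_iff, or_false] at hs
  tauto

theorem Lc_balanced : ∀ s ∈ Lc, s.e = s.w := by
  intro s hs
  rcases mem_Lc hs with rfl | rfl | rfl <;> rfl

theorem massesAfter_Lc : massesAfter aVec Lc = aVec := massesAfter_of_balanced _ _ Lc_balanced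

theorem massesBefore_Lc (m : ℕ) : massesBefore aVec Lc m = aVec :=
  massesBefore_of_balanced _ _ Lc_balanced m

theorem aVec_nonneg : ∀ i, 0 ≤ aVec i := by
  intro i
  fin_cases i <;> simp [aVec, hval] <;> norm_num

theorem aVec_sum : ∑ i, aVec i = 3 := by
  simp [Fin.sum_univ_four, aVec, hval]
  norm_num

theorem admissible_Lc : Admissible aVec Lc := by
  intro m hm
  show (Lc.get ⟨m, hm⟩).i ≠ (Lc.get ⟨m, hm⟩).j ∧ 0 ≤ (Lc.get ⟨m, hm⟩).e ∧
    (Lc.get ⟨m, hm⟩).e ≤ massesBefore aVec Lc m (Lc.get ⟨m, hm⟩).i ∧ 0 ≤ (Lc.get ⟨m, hm⟩).w ∧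
    (Lc.get ⟨m, hm⟩).w ≤ massesBefore aVec Lc m (Lc.get ⟨m, hm⟩).j
  rw [massesBefore_Lc]
  have hmem : Lc.get ⟨m, hm⟩ ∈ Lc := List.get_mem Lc ⟨m, hm⟩
  generalize Lc.get ⟨m, hm⟩ = s at hmem ⊢
  rcases mem_Lc hmem with rfl | rfl | rfl <;>
    simp [s01, s12, s23, aVec, hval] <;> norm_num

theorem fullyND_Lc : FullyNonDegenerate (1 / 10) aVec Lc := by
  intro m hm
  show (1 / 10 : ℝ) * massesBefore aVec Lc m (Lc.get ⟨m, hm⟩).i ≤ (Lc.get ⟨m, hm⟩).e ∧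
    (Lc.get ⟨m, hm⟩).e ≤ (1 - 1 / 10) * massesBefore aVec Lc m (Lc.get ⟨m, hm⟩).i ∧
    (1 / 10 : ℝ) * massesBefore aVec Lc m (Lc.get ⟨m, hm⟩).j ≤ (Lc.get ⟨m, hm⟩).w ∧
    (Lc.get ⟨m, hm⟩).w ≤ (1 - 1 / 10) * massesBefore aVec Lc m (Lc.get ⟨m, hm⟩).j
  rw [massesBefore_Lc]
  have hmem : Lc.get ⟨m, hm⟩ ∈ Lc := List.get_mem Lc ⟨m, hm⟩
  generalize Lc.get ⟨m, hm⟩ = s at hmem ⊢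
  rcases mem_Lc hmem with rfl | rfl | rfl <;>
    simp [s01, s12, s23, aVec, hval] <;> norm_num

theorem stepsOf_Lc : ∀ i, 3 ≤ stepsOf Lc i := by
  intro i
  fin_cases i <;> decide

theorem locality_Lc : LocalityBFK (fun K => K ^ 2) Lc := by
  intro S m₁ m₂ h12 h2 hfree
  have h2' : m₂ ≤ 9 := h2
  interval_cases m₂ <;> interval_cases m₁ <;> revert S <;> decide

theorem final_sq_Lc : 7 ≤ ∑ i, (massesAfter aVec Lc i) ^ 2 := by
  rw [massesAfter_Lc]
  simp [Fin.sum_univ_four, aVec, hval]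
  norm_num

/-- **The instance.** With `c₀ = 1/10`, `C K = K²`: a nonnegative mass vector of total mass `3` on
`n = 4` particles and an admissible, fully `c₀`-non-degenerate, `C`-local history in which every
particle takes `≥ 3` steps, whose final masses have `Σ a² ≥ 7`. So in `CascadeCore` (at these
`c₀, C` and any `η < 7`) the choice `m₀ = 3` fails; the general chain (file docstring) defeats every `m₀`. -/
theorem chain_instance :
    ∃ (a : Fin 4 → ℝ) (L : List (ExchangeStep 4)),
      (∀ i, 0 ≤ a i) ∧ ∑ i, a i = 3 ∧ Admissible a L ∧ FullyNonDegenerate (1 / 10) a L ∧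
      LocalityBFK (fun K => K ^ 2) L ∧ (∀ i, 3 ≤ stepsOf L i) ∧
      7 ≤ ∑ i, (massesAfter a L i) ^ 2 :=
  ⟨aVec, Lc, aVec_nonneg, aVec_sum, admissible_Lc, fullyND_Lc, locality_Lc, stepsOf_Lc, final_sq_Lc⟩

end

end Summit.AtomisticToContinuum.HydrodynamicLimit.Cruxes.DiffuseBackwardInfluence.TriageR1K3
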